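import Summits.Ventures.CertifiedManyBodySolver.Downfold.EmeryScaleLeverFI
import HarnessLib

/-!
# THE KERNEL-DECIDABLE PATH LEAF TEST OF THE SCALE COORDINATE AND ITS SOUNDNESS: `t_node(θ + s·d, e + s·σ) ≶ t_node(θ, e)` over fixed-point interval
# boxes through the ratio form `t′ = t·(1 + s·Ψ)` — the arithmetic core of the box checker, part II (INFL-3to1-B §B.88 (m))

Venture CertifiedManyBodySolver, cell `pub/hubbard-downfold` (stage S1; INFLATION-RULES-3to1-B §B.88), seat hubbard-downfold-mod-4 (technique B = band
level, g36); namespace `Summit.Ventures.CertifiedManyBodySolver.Downfold.Emery`. Everything PROVED (0 sorry). WHAT THIS IS NOT: a statement about any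
material; no number lives here; `U = 0` one-body kinematics of the σ model.

* §1 `fiStep`, `fiPsi` — FI image of the recursion `u ↦ u + ρ + s·u·ρ` defining `pathPsi` (`EmeryScaleNodeAtoms`), with `mem_fiPsi`.
* §2 **`pathLeaf upper …`**: positivity of the atoms of both rows, the five rates `ρF = dF/F`, `ρP = dP/P`, `ρE = −dE/E′`, `ρG = −dG/G′`, `ρQ = −dQ/Q′` by
  `FI.divPos`, and the sign test `Ψ.hi ≤ 0` (`upper = true`) / `0 ≤ Ψ.lo` (`upper = false`).
* §3 SOUNDNESS `scaleNode_le_of_pathLeaf` (`upper = true` ⇒ `N′/D′ ≤ N/D`) and `scaleNode_ge_of_pathLeaf` (`upper = false` ⇒ `N/D ≤ N′/D′`) for all reals in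
  the boxes, where `N/D = scaleNodeN/scaleNodeD` at the row `θ = (Δ, a, b, c)` and energy `e`, and `N′/D′` at `θ + s·(dΔ, da, db, dc)`, `e + s·σ`.

Sources: three-band model [HybertsenSchluterChristensen1989, Eq. (1)]; energy-linearised one-band image [AndersenEtAl1995, §6]; interval arithmetic
[folklore] (Moore 1966).
-/

noncomputable section

namespace Summit.Ventures.CertifiedManyBodySolver.Downfold.Emery

open Real Set Literature.Analysis.ValidatedNumerics.Numerics

/-! ## §1 The image of `pathPsi` -/

/-- One step `u ↦ u + ρ + s·u·ρ` in FI. [folklore] -/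
def fiStep (IS U Rh : FI) : FI := (U.add Rh).add ((IS.mul U).mul Rh)

/-- Inclusion of `fiStep`. [folklore] -/
theorem mem_fiStep {s u ρ : ℝ} {IS U Rh : FI} (hs : FI.mem s IS) (hu : FI.mem u U) (hr : FI.mem ρ Rh) :
    FI.mem (u + ρ + s * u * ρ) (fiStep IS U Rh) := by
  unfold fiStep
  exact mem_of_eq (FI.mem_add (FI.mem_add hu hr) (FI.mem_mul (FI.mem_mul hs hu) hr)) (by ring)

/-- FI image of `pathPsi s ρF ρP ρE ρG ρQ`. [folklore] -/
def fiPsi (IS RF RP RE RG RQ : FI) : FI :=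
  fiStep IS (fiStep IS (fiStep IS (fiStep IS (fiStep IS RF RP) RP) RE) RG) RQ

/-- Inclusion of `fiPsi`. [folklore] -/
theorem mem_fiPsi {s ρF ρP ρE ρG ρQ : ℝ} {IS RF RP RE RG RQ : FI} (hs : FI.mem s IS) (hF : FI.mem ρF RF) (hP : FI.mem ρP RP) (hE : FI.mem ρE RE)
    (hG : FI.mem ρG RG) (hQ : FI.mem ρQ RQ) : FI.mem (pathPsi s ρF ρP ρE ρG ρQ) (fiPsi IS RF RP RE RG RQ) := by
  have h2 := mem_fiStep hs hF hP
  have h3 := mem_fiStep hs h2 hP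
  have h4 := mem_fiStep hs h3 hE
  have h5 := mem_fiStep hs h4 hG
  have h6 := mem_fiStep hs h5 hQ
  unfold fiPsi
  exact mem_of_eq h6 (by unfold pathPsi; ring)

/-! ## §2 The path leaf -/

/-- **`pathLeaf upper …`** — kernel-decidable sufficient condition for `t_node(θ + s·d, e + s·σ) ≤ t_node(θ, e)` (`upper = true`) or `≥` (`upper = false`)
uniformly over the input boxes (rows `θ = (Δ, a, b, c)`, energies `e`, move `(dΔ, da, db, dc, σ)`, steps `s ≥ 0`). [folklore] -/
def pathLeaf (upper : Bool) (ID IA IB IC IE IDD IDA IDB IDC ISG IS : FI) : Bool :=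
  let E0 := fiE ID IE
  let G := fiG IA IB IE
  let P := fiP IA IB IC IE
  let Q := fiQ ID IA IB IC IE
  let F := fiF ID IA IB IC IE
  let dE := fidE IDD ISG
  let dG := fidG IA IB IE IDA IDB ISG IS
  let dP := fidP IA IB IC IE IDA IDB IDC ISG IS
  let dQ := fidQ ID IA IB IC IE IDD IDA IDB IDC ISG IS
  let dF := fidF ID IA IB IC IE IDD IDA IDB IDC ISG IS
  let E2 := E0.add (IS.mul dE)
  let G2 := G.add (IS.mul dG)
  let Q2 := Q.add (IS.mul dQ)
  decide (0 ≤ IS.lo) && decide (0 < E0.lo) && decide (0 < G.lo) && decide (0 < Q.lo) && decide (0 < F.lo) && decide (0 < P.lo) &&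
    decide (0 < E2.lo) && decide (0 < G2.lo) && decide (0 < Q2.lo) &&
  match FI.divPos dF F, FI.divPos dP P, FI.divPos dE.neg E2, FI.divPos dG.neg G2, FI.divPos dQ.neg Q2 with
  | some rF, some rP, some rE, some rG, some rQ =>
      if upper then decide ((fiPsi IS rF rP rE rG rQ).hi ≤ 0) else decide (0 ≤ (fiPsi IS rF rP rE rG rQ).lo)
  | _, _, _, _, _ => false

/-! ## §3 Soundness -/

section Sound

variable {ID IA IB IC IE IDD IDA IDB IDC ISG IS : FI} {Δ a b c e dΔ da db dc σ s : ℝ}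

/-- The common part of the two soundness proofs: the ratio form and the signs. [folklore] -/
theorem pathLeaf_ratio {upper : Bool} (h : pathLeaf upper ID IA IB IC IE IDD IDA IDB IDC ISG IS = true) (hD : FI.mem Δ ID) (hA : FI.mem a IA)
    (hB : FI.mem b IB) (hC : FI.mem c IC) (hE : FI.mem e IE) (hDD : FI.mem dΔ IDD) (hDA : FI.mem da IDA) (hDB : FI.mem db IDB) (hDC : FI.mem dc IDC)
    (hSG : FI.mem σ ISG) (hS : FI.mem s IS) :
    ∃ Ψ : ℝ, scaleNodeN (Δ + s * dΔ) (a + s * da) (b + s * db) (c + s * dc) (e + s * σ) / scaleNodeD (Δ + s * dΔ) (a + s * da) (b + s * db) (c + s * dc) (e + s * σ) =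
        scaleNodeN Δ a b c e / scaleNodeD Δ a b c e * (1 + s * Ψ) ∧
      0 ≤ scaleNodeN Δ a b c e / scaleNodeD Δ a b c e ∧ 0 ≤ s ∧ (upper = true → Ψ ≤ 0) ∧ (upper = false → 0 ≤ Ψ) := by
  have mE0 := mem_fiE hD hE
  have mG := mem_fiG hA hB hE
  have mP := mem_fiP hA hB hC hE
  have mQ := mem_fiQ hD hA hB hC hE
  have mF := mem_fiF hD hA hB hC hE
  have mdE := mem_fidE hDD hSG
  have mdG := mem_fidG hA hB hE hDA hDB hSG hS
  have mdP := mem_fidP hA hB hC hE hDA hDB hDC hSG hS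
  have mdQ := mem_fidQ hD hA hB hC hE hDD hDA hDB hDC hSG hS
  have mdF := mem_fidF hD hA hB hC hE hDD hDA hDB hDC hSG hS
  have mE2 := FI.mem_add mE0 (FI.mem_mul hS mdE)
  have mG2 := FI.mem_add mG (FI.mem_mul hS mdG)
  have mQ2 := FI.mem_add mQ (FI.mem_mul hS mdQ)
  unfold pathLeaf at h
  simp only [Bool.and_eq_true, decide_eq_true_eq] at h
  obtain ⟨⟨⟨⟨⟨⟨⟨⟨⟨hs0, hE0⟩, hG0⟩, hQ0⟩, hF0⟩, hP0⟩, hE2⟩, hG2⟩, hQ2⟩, hrest⟩ := h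
  have Hs : 0 ≤ s := nonneg_of_lo_nonneg hS hs0
  have HE : 0 < snE Δ e := FI.pos_of_lo_pos mE0 hE0
  have HG : 0 < snG a b e := FI.pos_of_lo_pos mG hG0
  have HQ : 0 < snQ Δ a b c e := FI.pos_of_lo_pos mQ hQ0
  have HF : 0 < snF Δ a b c e := FI.pos_of_lo_pos mF hF0
  have HP : 0 < snP a b c e := FI.pos_of_lo_pos mP hP0
  have HE2 : 0 < snE Δ e + s * dsnE dΔ σ := FI.pos_of_lo_pos mE2 hE2
  have HG2 : 0 < snG a b e + s * dsnG a b e da db σ s := FI.pos_of_lo_pos mG2 hG2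
  have HQ2 : 0 < snQ Δ a b c e + s * dsnQ Δ a b c e dΔ da db dc σ s := FI.pos_of_lo_pos mQ2 hQ2
  split at hrest
  · rename_i rF rP rE rG rQ hrF hrP hrE hrG hrQ
    set F := snF Δ a b c e
    set P := snP a b c e
    set E0 := snE Δ e
    set G := snG a b e
    set Q := snQ Δ a b c e
    set dF := dsnF Δ a b c e dΔ da db dc σ s
    set dP := dsnP a b c e da db dc σ s
    set dE := dsnE dΔ σ
    set dG := dsnG a b e da db σ s
    set dQ := dsnQ Δ a b c e dΔ da db dc σ s
    have mρF : FI.mem (dF / F) rF := FI.mem_divPos hrF mdF mF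
    have mρP : FI.mem (dP / P) rP := FI.mem_divPos hrP mdP mP
    have mρE : FI.mem (-dE / (E0 + s * dE)) rE := FI.mem_divPos hrE (FI.mem_neg mdE) mE2
    have mρG : FI.mem (-dG / (G + s * dG)) rG := FI.mem_divPos hrG (FI.mem_neg mdG) mG2
    have mρQ : FI.mem (-dQ / (Q + s * dQ)) rQ := FI.mem_divPos hrQ (FI.mem_neg mdQ) mQ2
    have mΨ := mem_fiPsi hS mρF mρP mρE mρG mρQ
    refine ⟨pathPsi s (dF / F) (dP / P) (-dE / (E0 + s * dE)) (-dG / (G + s * dG)) (-dQ / (Q + s * dQ)), ?_, ?_, Hs, ?_, ?_⟩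
    · have key := scaleNode_move_ratio (s := s) (div_mul_cancel₀ dF HF.ne') (div_mul_cancel₀ dP HP.ne') (div_mul_cancel₀ (-dE) HE2.ne')
        (div_mul_cancel₀ (-dG) HG2.ne') (div_mul_cancel₀ (-dQ) HQ2.ne') (by positivity) (by positivity)
      rw [scaleNodeN_eq_sn, scaleNodeD_eq_sn, scaleNodeN_eq_sn, scaleNodeD_eq_sn, snF_move, snP_move, snE_move, snG_move, snQ_move]
      exact key
    · rw [scaleNodeN_eq_sn, scaleNodeD_eq_sn]; positivity
    · intro hu
      rw [hu, if_pos rfl, decide_eq_true_eq] at hrest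
      exact nonpos_of_hi_nonpos mΨ hrest
    · intro hu
      rw [hu] at hrest
      simp only [Bool.false_eq_true, ↓reduceIte, decide_eq_true_eq] at hrest
      exact nonneg_of_lo_nonneg mΨ hrest
  · exact absurd hrest Bool.false_ne_true

/-- **SOUNDNESS OF `pathLeaf true`**: `t_node(θ + s·d, e + s·σ) ≤ t_node(θ, e)` for all reals in the boxes. [folklore] -/
theorem scaleNode_le_of_pathLeaf (h : pathLeaf true ID IA IB IC IE IDD IDA IDB IDC ISG IS = true) (hD : FI.mem Δ ID) (hA : FI.mem a IA)
    (hB : FI.mem b IB) (hC : FI.mem c IC) (hE : FI.mem e IE) (hDD : FI.mem dΔ IDD) (hDA : FI.mem da IDA) (hDB : FI.mem db IDB) (hDC : FI.mem dc IDC)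
    (hSG : FI.mem σ ISG) (hS : FI.mem s IS) :
    scaleNodeN (Δ + s * dΔ) (a + s * da) (b + s * db) (c + s * dc) (e + s * σ) / scaleNodeD (Δ + s * dΔ) (a + s * da) (b + s * db) (c + s * dc) (e + s * σ) ≤
      scaleNodeN Δ a b c e / scaleNodeD Δ a b c e := by
  obtain ⟨Ψ, hratio, ht, hs, hup, -⟩ := pathLeaf_ratio h hD hA hB hC hE hDD hDA hDB hDC hSG hS
  exact (le_of_ratio_form hratio ht hs).1 (hup rfl)

/-- **SOUNDNESS OF `pathLeaf false`**: `t_node(θ, e) ≤ t_node(θ + s·d, e + s·σ)` for all reals in the boxes. [folklore] -/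
theorem scaleNode_ge_of_pathLeaf (h : pathLeaf false ID IA IB IC IE IDD IDA IDB IDC ISG IS = true) (hD : FI.mem Δ ID) (hA : FI.mem a IA)
    (hB : FI.mem b IB) (hC : FI.mem c IC) (hE : FI.mem e IE) (hDD : FI.mem dΔ IDD) (hDA : FI.mem da IDA) (hDB : FI.mem db IDB) (hDC : FI.mem dc IDC)
    (hSG : FI.mem σ ISG) (hS : FI.mem s IS) :
    scaleNodeN Δ a b c e / scaleNodeD Δ a b c e ≤
      scaleNodeN (Δ + s * dΔ) (a + s * da) (b + s * db) (c + s * dc) (e + s * σ) / scaleNodeD (Δ + s * dΔ) (a + s * da) (b + s * db) (c + s * dc) (e + s * σ) := by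
  obtain ⟨Ψ, hratio, ht, hs, -, hlo⟩ := pathLeaf_ratio h hD hA hB hC hE hDD hDA hDB hDC hSG hS
  exact (le_of_ratio_form hratio ht hs).2 (hlo rfl)

end Sound

end Summit.Ventures.CertifiedManyBodySolver.Downfold.Emery
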